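import Summits.AnomalousDissipation.AnomalousDissipation.Theorems.SolenoidalFractalHomogenisationLagrangianStepSidebandBlockMatrix
import Mathlib.MeasureTheory.Integral.DominatedConvergence
import HarnessLib

/-!
# K1L_D `stub_D1_residueTail` (registry v17, stmt-AnomalousDissipation-27980) — lane A1 brick III(d): THE DOUBLE SLOT INTEGRAL OF THE OWN-SLOT
# BLOCK SEMIGROUP IS `T⁻¹ • slotQ` (helper; `--supports stmt-AnomalousDissipation-27980`)

Summits-side helper file of route `SolenoidalFractalHomogenisation` (prover seat `ad-sawtooth-k1loc-p1` g13; lane A of the tail certificate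
`Lines/onelevel-D1-tail-cert.md`; identification `diag psiStar = excQS`, `κ = 1`, variant A of D26-7).  Everything proved; no definitions, no named facts,
no sorry.  Entrywise (scalar) integrals only — the matrix-valued Bochner integral is avoided on purpose (the `ℓ^∞`-operator norm on `Matrix` is a
scoped instance whose topology is not reducibly the product topology, so `IntervalIntegrable` does not elaborate for matrix-valued maps).
Writing `cmat A := Matrix.toEuclideanCLM (A.map (↑))` (existing Mathlib equivalence, used inline) and `a = trapezoid 0 1 ρ`:
* `exp_blockGen_transversalProj_apply` — coordinates of the own-slot semigroup on transversal data:
  `(exp(σ•B↾ℝ)(P_m v))_i = Σ_l ((exp(−(σ·4π²ν|m|²))•B̂)·P̂)_{il} · v_l` (`…SidebandBlockMatrix.exp_blockGen_transversalProj`);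
* `integral_integral_ofReal_mul` — real casts commute with the double slot integral (no integrability needed);
* `integral_sum_sum_const_mul`, `integral_integral_sum_sum` — finite double sums with constant coefficients commute with the (double) slot integral;
* `intervalIntegral_apply_coord` — coordinates of a `ℂ³`-valued slot integral;
* **`integral_integral_exp_blockGen_eq`** — for `𝔸 = ν•S`, a lattice phase `P` and a slot length `L` with `T = L·4π²ν|m|² ≠ 0`:
  `∫₀¹ a(u) • ∫₀ᵘ a(x) • exp((L(u−x))•(blockGen (ν•S) γ₁ m)↾ℝ)(P_m v) dx du = (T⁻¹ : ℂ) • cmat(qsResp ρ T (regBlock S m̂)·projPerp m̂) v` — the own-slot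
  kernel of `M_{jj}` after the slot-time substitution (`…SidebandSlotTime.double_integral_slot_subst`) IS `slotQ` up to the scalar `T⁻¹`.
NOT a proof of any registered stub, of the crux, or of anomalous dissipation; rung leaf F-D1 infrastructure.
-/

set_option linter.dupNamespace false

noncomputable section

namespace Summit.AnomalousDissipation.AnomalousDissipation.Theorems.SolenoidalFractalHomogenisation.LagrangianStep.Sideband

open Set MeasureTheory Complex Matrix intervalIntegral
open scoped InnerProductSpace
open Literature.Analysis Literature.Analysis.FunctionSpaces Literature.Analysis.FunctionSpaces.Torus
open Literature.Analysis.FluidPDE Literature.Analysis.FluidPDE.Torus Literature.Analysis.FluidPDE.LatticeShear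

variable {k₀ : ℕ}

/-! ## §1 Coordinates of the own-slot semigroup on transversal data -/

/-- **Coordinates of `exp(σ•B↾ℝ)(P_m v)`** for `𝔸 = ν•S` and a lattice phase `P` (`m = P.m`, `m̂ = mhat P`, `P̂ = projPerp m̂`, `B̂ = regBlock S m̂`):
`(exp(σ•B↾ℝ)(P_m v))_i = Σ_l ((exp(−(σ·4π²ν|m|²))•B̂)·P̂)_{il} · v_l`. [cite: MajdaKramer1999, §2.2.1.3 (cell problem (49))] [cite: Hale1980, Ch. III §1, Theorem 1.1] -/
theorem exp_blockGen_transversalProj_apply (S : Torus.Visc4 (Fin 3)) (ν γ₁ : ℝ) (P : LatticePhase) (σ : ℝ) (v : EuclideanSpace ℂ (Fin 3)) (i : Fin 3) :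
    NormedSpace.exp (σ • (blockGen (ν • S) γ₁ P.m).restrictScalars ℝ) (transversalProj P.m v) i =
      ∑ l, ((NormedSpace.exp (-(σ * (4 * Real.pi ^ 2 * ν * ‖latticeVec P.m‖ ^ 2)) • regBlock S (mhat P)) * projPerp (mhat P)) i l : ℂ) * v l := by
  rw [exp_blockGen_transversalProj, toEuclideanCLM_map_apply]

/-- Joint continuity of the entries of the projected slot kernel `(u, x) ↦ ((exp(−T(u−x))•B)·Q)_{il}`. [folklore] -/
theorem continuous_qsKernel_mul_apply (T : ℝ) (B Q : Matrix (Fin 3) (Fin 3) ℝ) (i l : Fin 3) :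
    Continuous fun p : ℝ × ℝ => ((NormedSpace.exp (-(T * (p.1 - p.2)) • B)) * Q) i l := by
  simp only [Matrix.mul_apply]
  exact continuous_finsetSum _ fun k _ => (continuous_qsKernel_apply T B i k).mul continuous_const

/-! ## §2 Scalar bookkeeping: real casts and finite sums through the double slot integral -/

/-- Real casts commute with the double slot integral:
`∫₀¹ ↑(a u) * ∫₀ᵘ ↑(a x) * ↑(g u x) dx du = ↑(∫₀¹ a u * ∫₀ᵘ a x * g u x dx du)` (no integrability needed). [folklore] -/
theorem integral_integral_ofReal_mul (ρ : ℝ) (g : ℝ → ℝ → ℝ) :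
    ∫ u in (0:ℝ)..1, ((LatticeWord.trapezoid 0 1 ρ u : ℝ) : ℂ) * ∫ x in (0:ℝ)..u, ((LatticeWord.trapezoid 0 1 ρ x : ℝ) : ℂ) * ((g u x : ℝ) : ℂ) =
      (((∫ u in (0:ℝ)..1, LatticeWord.trapezoid 0 1 ρ u * ∫ x in (0:ℝ)..u, LatticeWord.trapezoid 0 1 ρ x * g u x : ℝ)) : ℂ) := by
  rw [← intervalIntegral.integral_ofReal]
  refine intervalIntegral.integral_congr fun u _ => ?_
  show ((LatticeWord.trapezoid 0 1 ρ u : ℝ) : ℂ) * ∫ x in (0:ℝ)..u, ((LatticeWord.trapezoid 0 1 ρ x : ℝ) : ℂ) * ((g u x : ℝ) : ℂ) =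
    (((LatticeWord.trapezoid 0 1 ρ u * ∫ x in (0:ℝ)..u, LatticeWord.trapezoid 0 1 ρ x * g u x : ℝ)) : ℂ)
  rw [Complex.ofReal_mul, ← intervalIntegral.integral_ofReal]
  congr 1
  refine intervalIntegral.integral_congr fun x _ => ?_
  show ((LatticeWord.trapezoid 0 1 ρ x : ℝ) : ℂ) * ((g u x : ℝ) : ℂ) = (((LatticeWord.trapezoid 0 1 ρ x * g u x : ℝ)) : ℂ)
  rw [Complex.ofReal_mul]

/-- Finite double sums with constant coefficients commute with ONE slot integral of continuous complex integrands. [folklore] -/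
theorem integral_sum_sum_const_mul {f : Fin 3 → Fin 3 → ℝ → ℂ} (c : Fin 3 → Fin 3 → ℂ) (hf : ∀ l k, Continuous (f l k)) (a b : ℝ) :
    ∫ x in a..b, ∑ l, ∑ k, c l k * f l k x = ∑ l, ∑ k, c l k * ∫ x in a..b, f l k x := by
  rw [intervalIntegral.integral_finsetSum]
  · refine Finset.sum_congr rfl fun l _ => ?_
    rw [intervalIntegral.integral_finsetSum]
    · exact Finset.sum_congr rfl fun k _ => intervalIntegral.integral_const_mul _ _
    · exact fun k _ => ((hf l k).intervalIntegrable (μ := volume) a b).const_mul _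
  · intro l _
    have h := IntervalIntegrable.sum Finset.univ fun k (_ : k ∈ Finset.univ) =>
      (((hf l k).intervalIntegrable (μ := volume) a b).const_mul (c l k))
    rw [Finset.sum_fn] at h
    exact h

/-- **Finite double sums with constant coefficients commute with the double slot integral** (jointly continuous real kernels `g l k`):
`∫₀¹ ↑a(u) ∫₀ᵘ ↑a(x) Σ_{l,k} c_{lk} ↑(g l k u x) = Σ_{l,k} c_{lk} ∫₀¹ ↑a(u) ∫₀ᵘ ↑a(x) ↑(g l k u x)`. [folklore] -/
theorem integral_integral_sum_sum (ρ : ℝ) {g : Fin 3 → Fin 3 → ℝ → ℝ → ℝ} (hg : ∀ l k, Continuous (Function.uncurry (g l k)))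
    (c : Fin 3 → Fin 3 → ℂ) :
    ∫ u in (0:ℝ)..1, ((LatticeWord.trapezoid 0 1 ρ u : ℝ) : ℂ) * ∫ x in (0:ℝ)..u, ((LatticeWord.trapezoid 0 1 ρ x : ℝ) : ℂ) *
        ∑ l, ∑ k, c l k * ((g l k u x : ℝ) : ℂ) =
      ∑ l, ∑ k, c l k * ∫ u in (0:ℝ)..1, ((LatticeWord.trapezoid 0 1 ρ u : ℝ) : ℂ) * ∫ x in (0:ℝ)..u, ((LatticeWord.trapezoid 0 1 ρ x : ℝ) : ℂ) *
        ((g l k u x : ℝ) : ℂ) := by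
  have hac : Continuous fun s : ℝ => ((LatticeWord.trapezoid 0 1 ρ s : ℝ) : ℂ) := Complex.continuous_ofReal.comp (continuous_trapezoid_unit ρ)
  -- inner integrands
  have hin : ∀ l k u, Continuous fun x : ℝ => ((LatticeWord.trapezoid 0 1 ρ x : ℝ) : ℂ) * ((g l k u x : ℝ) : ℂ) := fun l k u =>
    hac.mul (Complex.continuous_ofReal.comp ((hg l k).comp (continuous_const.prodMk continuous_id)))
  -- outer integrands
  have hout : ∀ l k, Continuous fun u : ℝ => ((LatticeWord.trapezoid 0 1 ρ u : ℝ) : ℂ) *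
      ∫ x in (0:ℝ)..u, ((LatticeWord.trapezoid 0 1 ρ x : ℝ) : ℂ) * ((g l k u x : ℝ) : ℂ) := by
    intro l k
    have hf : Continuous (Function.uncurry fun u x : ℝ => ((LatticeWord.trapezoid 0 1 ρ x : ℝ) : ℂ) * ((g l k u x : ℝ) : ℂ)) :=
      (hac.comp continuous_snd).mul (Complex.continuous_ofReal.comp (hg l k))
    exact hac.mul (intervalIntegral.continuous_parametric_intervalIntegral_of_continuous (a₀ := 0) hf continuous_id)
  -- inner step, pointwise in `u`
  have hinner : ∀ u, ∫ x in (0:ℝ)..u, ((LatticeWord.trapezoid 0 1 ρ x : ℝ) : ℂ) * ∑ l, ∑ k, c l k * ((g l k u x : ℝ) : ℂ) =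
      ∑ l, ∑ k, c l k * ∫ x in (0:ℝ)..u, ((LatticeWord.trapezoid 0 1 ρ x : ℝ) : ℂ) * ((g l k u x : ℝ) : ℂ) := by
    intro u
    rw [← integral_sum_sum_const_mul c (fun l k => hin l k u)]
    refine intervalIntegral.integral_congr fun x _ => ?_
    show ((LatticeWord.trapezoid 0 1 ρ x : ℝ) : ℂ) * ∑ l, ∑ k, c l k * ((g l k u x : ℝ) : ℂ) =
      ∑ l, ∑ k, c l k * (((LatticeWord.trapezoid 0 1 ρ x : ℝ) : ℂ) * ((g l k u x : ℝ) : ℂ))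
    rw [Finset.mul_sum]
    refine Finset.sum_congr rfl fun l _ => ?_
    rw [Finset.mul_sum]
    refine Finset.sum_congr rfl fun k _ => ?_
    ring
  -- outer step
  rw [← integral_sum_sum_const_mul c hout]
  refine intervalIntegral.integral_congr fun u _ => ?_
  show ((LatticeWord.trapezoid 0 1 ρ u : ℝ) : ℂ) * (∫ x in (0:ℝ)..u, ((LatticeWord.trapezoid 0 1 ρ x : ℝ) : ℂ) * ∑ l, ∑ k, c l k * ((g l k u x : ℝ) : ℂ)) =
    ∑ l, ∑ k, c l k * (((LatticeWord.trapezoid 0 1 ρ u : ℝ) : ℂ) * ∫ x in (0:ℝ)..u, ((LatticeWord.trapezoid 0 1 ρ x : ℝ) : ℂ) * ((g l k u x : ℝ) : ℂ))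
  rw [hinner u, Finset.mul_sum]
  refine Finset.sum_congr rfl fun l _ => ?_
  rw [Finset.mul_sum]
  refine Finset.sum_congr rfl fun k _ => ?_
  ring

/-! ## §3 The own-slot kernel after the slot-time substitution is `T⁻¹ • slotQ` -/

/-- Coordinates of a `ℂ³`-valued slot integral: `(∫ f) i = ∫ (f · i)`. [folklore] -/
theorem intervalIntegral_apply_coord {f : ℝ → EuclideanSpace ℂ (Fin 3)} {a b : ℝ} (hf : IntervalIntegrable f volume a b) (i : Fin 3) :
    (∫ x in a..b, f x) i = ∫ x in a..b, f x i := by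
  have h := ((EuclideanSpace.proj i : EuclideanSpace ℂ (Fin 3) →L[ℂ] ℂ).intervalIntegral_comp_comm hf).symm
  simpa using h

/-- **THE OWN-SLOT KERNEL IS `slotQ` UP TO `T⁻¹`.**  For `𝔸 = ν•S`, a lattice phase `P` (`m = P.m`, `m̂ = mhat P`) and a slot length `L` with
`T = L·4π²ν|m|² ≠ 0`: `∫₀¹ a(u) • ∫₀ᵘ a(x) • exp((L(u−x))•(blockGen (ν•S) γ₁ m)↾ℝ)(P_m v) dx du = (T⁻¹ : ℂ) • cmat(qsResp ρ T (regBlock S m̂) · projPerp m̂) v`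
(`a = trapezoid 0 1 ρ`, real scalars). [cite: MajdaKramer1999, §2.2.1.3 (cell problem (49))] [cite: Hale1980, Ch. III §1, Theorem 1.1] -/
theorem integral_integral_exp_blockGen_eq (S : Torus.Visc4 (Fin 3)) (ν γ₁ : ℝ) (P : LatticePhase) (ρ : ℝ) {L : ℝ}
    (hT : L * (4 * Real.pi ^ 2 * ν * ‖latticeVec P.m‖ ^ 2) ≠ 0) (v : EuclideanSpace ℂ (Fin 3)) :
    ∫ u in (0:ℝ)..1, LatticeWord.trapezoid 0 1 ρ u • ∫ x in (0:ℝ)..u, LatticeWord.trapezoid 0 1 ρ x •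
        NormedSpace.exp ((L * (u - x)) • (blockGen (ν • S) γ₁ P.m).restrictScalars ℝ) (transversalProj P.m v) =
      ((L * (4 * Real.pi ^ 2 * ν * ‖latticeVec P.m‖ ^ 2))⁻¹ : ℂ) •
        Matrix.toEuclideanCLM (n := Fin 3) (𝕜 := ℂ)
          ((qsResp ρ (L * (4 * Real.pi ^ 2 * ν * ‖latticeVec P.m‖ ^ 2)) (regBlock S (mhat P)) * projPerp (mhat P)).map ((↑) : ℝ → ℂ)) v := by
  have hTc : ((L : ℂ) * (4 * (Real.pi : ℂ) ^ 2 * (ν : ℂ) * ((‖latticeVec P.m‖ : ℝ) : ℂ) ^ 2)) ≠ 0 := by exact_mod_cast hT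
  set T : ℝ := L * (4 * Real.pi ^ 2 * ν * ‖latticeVec P.m‖ ^ 2) with hTdef
  set Bh := regBlock S (mhat P) with hBh
  set Ph := projPerp (mhat P) with hPh
  set Bℝ := (blockGen (ν • S) γ₁ P.m).restrictScalars ℝ with hBℝ
  -- the kernel in coordinates: `K(L σ) i = Σ_l Σ_k exp(−Tσ B̂)_{ik} P̂_{kl} v_l`
  have hK : ∀ σ : ℝ, ∀ i, NormedSpace.exp ((L * σ) • Bℝ) (transversalProj P.m v) i =
      ∑ l, ∑ k, ((Ph k l : ℂ) * v l) * (((NormedSpace.exp (-(T * σ) • Bh)) i k : ℝ) : ℂ) := by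
    intro σ i
    rw [hBℝ, exp_blockGen_transversalProj_apply]
    have e : -(L * σ * (4 * Real.pi ^ 2 * ν * ‖latticeVec P.m‖ ^ 2)) = -(T * σ) := by rw [hTdef]; ring
    rw [e]
    refine Finset.sum_congr rfl fun l _ => ?_
    simp only [Matrix.mul_apply, ← hBh, ← hPh]
    push_cast
    rw [Finset.sum_mul]
    exact Finset.sum_congr rfl fun k _ => by ring
  -- continuity / integrability of the vector integrands
  have hEc : Continuous fun σ : ℝ => NormedSpace.exp (σ • Bℝ) :=
    continuous_iff_continuousAt.2 fun σ => (hasDerivAt_exp_smul_const Bℝ σ).continuousAt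
  have hKc : Continuous fun p : ℝ × ℝ => NormedSpace.exp ((L * (p.1 - p.2)) • Bℝ) (transversalProj P.m v) :=
    (hEc.comp (by fun_prop : Continuous fun p : ℝ × ℝ => L * (p.1 - p.2))).clm_apply continuous_const
  have hinner_c : ∀ u, Continuous fun x : ℝ => LatticeWord.trapezoid 0 1 ρ x • NormedSpace.exp ((L * (u - x)) • Bℝ) (transversalProj P.m v) :=
    fun u => (continuous_trapezoid_unit ρ).smul (hKc.comp (continuous_const.prodMk continuous_id))
  have houter_c : Continuous fun u : ℝ => LatticeWord.trapezoid 0 1 ρ u •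
      ∫ x in (0:ℝ)..u, LatticeWord.trapezoid 0 1 ρ x • NormedSpace.exp ((L * (u - x)) • Bℝ) (transversalProj P.m v) := by
    have hf : Continuous (Function.uncurry fun u x : ℝ =>
        LatticeWord.trapezoid 0 1 ρ x • NormedSpace.exp ((L * (u - x)) • Bℝ) (transversalProj P.m v)) :=
      ((continuous_trapezoid_unit ρ).comp continuous_snd).smul hKc
    exact (continuous_trapezoid_unit ρ).smul (intervalIntegral.continuous_parametric_intervalIntegral_of_continuous (a₀ := 0) hf continuous_id)
  -- compare coordinates
  ext i
  rw [intervalIntegral_apply_coord (houter_c.intervalIntegrable _ _) i, PiLp.smul_apply, toEuclideanCLM_map_apply, smul_eq_mul]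
  -- LHS coordinate as a complex double integral of entry kernels
  have hL : ∫ u in (0:ℝ)..1, (LatticeWord.trapezoid 0 1 ρ u •
        ∫ x in (0:ℝ)..u, LatticeWord.trapezoid 0 1 ρ x • NormedSpace.exp ((L * (u - x)) • Bℝ) (transversalProj P.m v)) i =
      ∫ u in (0:ℝ)..1, ((LatticeWord.trapezoid 0 1 ρ u : ℝ) : ℂ) * ∫ x in (0:ℝ)..u, ((LatticeWord.trapezoid 0 1 ρ x : ℝ) : ℂ) *
        ∑ l, ∑ k, ((Ph k l : ℂ) * v l) * (((NormedSpace.exp (-(T * (u - x)) • Bh)) i k : ℝ) : ℂ) := by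
    refine intervalIntegral.integral_congr fun u _ => ?_
    show (LatticeWord.trapezoid 0 1 ρ u • ∫ x in (0:ℝ)..u, LatticeWord.trapezoid 0 1 ρ x •
        NormedSpace.exp ((L * (u - x)) • Bℝ) (transversalProj P.m v)) i = _
    rw [PiLp.smul_apply, intervalIntegral_apply_coord ((hinner_c u).intervalIntegrable _ _) i, Complex.real_smul]
    congr 1
    refine intervalIntegral.integral_congr fun x _ => ?_
    show (LatticeWord.trapezoid 0 1 ρ x • NormedSpace.exp ((L * (u - x)) • Bℝ) (transversalProj P.m v)) i = _
    rw [PiLp.smul_apply, Complex.real_smul, hK (u - x) i]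
  rw [hL, integral_integral_sum_sum ρ (g := fun _ k u x => (NormedSpace.exp (-(T * (u - x)) • Bh)) i k)
    (fun _ k => continuous_qsKernel_apply T Bh i k) (fun l k => (Ph k l : ℂ) * v l)]
  -- RHS coordinate
  rw [Finset.mul_sum]
  refine Finset.sum_congr rfl fun l _ => ?_
  simp only [Matrix.mul_apply]
  push_cast
  rw [Finset.sum_mul, Finset.mul_sum]
  refine Finset.sum_congr rfl fun k _ => ?_
  rw [integral_integral_ofReal_mul ρ (fun u x => (NormedSpace.exp (-(T * (u - x)) • Bh)) i k)]
  -- `qsResp i k = T * ∫∫ a a exp_{ik}`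
  have hq : qsResp ρ T Bh i k = T * ∫ u in (0:ℝ)..1, LatticeWord.trapezoid 0 1 ρ u *
      ∫ x in (0:ℝ)..u, LatticeWord.trapezoid 0 1 ρ x * (NormedSpace.exp (-(T * (u - x)) • Bh)) i k := rfl
  have hTc' : ((T : ℝ) : ℂ) = (L : ℂ) * (4 * (Real.pi : ℂ) ^ 2 * (ν : ℂ) * ((‖latticeVec P.m‖ : ℝ) : ℂ) ^ 2) := by
    rw [hTdef]; push_cast; ring
  have hT' : ((T : ℝ) : ℂ) ≠ 0 := by exact_mod_cast hT
  rw [hq, ← hTc']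
  push_cast
  field_simp

end Summit.AnomalousDissipation.AnomalousDissipation.Theorems.SolenoidalFractalHomogenisation.LagrangianStep.Sideband

end
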